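import Summits.QuantumFields.BalabanUV.Beta.EriceFlowEnclosureB12AsPrintedPointwiseFadingLimit

/-!
# Beta / EriceFlowEnclosureB12AsPrintedPointwiseFadingLimitWitness — WHAT (0.31) FORCES, part 11f: BOTH LETTERS OF PART 11 ARE LOAD-BEARING.  Part 11 (`…PointwiseFadingLimit`) derived the asymptotic
# constant `b⋆ = lim_{u→0⁺} betaInf β (u,u,…)` and the sandwich `|β_{k+1}(v) − b⋆| ≤ 2Cδ∕(1−θ) + cθ^k∕(1−θ)` from node U2's coupling-chart MODULI (`HistLipschitz` ∕ `FadingMemory`) together with NE4 (`ScaleShiftRate`).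
# Two def-free toys (ours, written as lambdas; NOT Bałaban's β) show that neither letter can be dropped:
# §1 NE4 WITHOUT THE MODULI — the stationary Markov family `β_{k+1}(g_0,…,g_k) = sin(1∕g_k)`: it satisfies `ScaleShiftRate 0 θ γ` for EVERY θ, γ (a function of the last coupling is its own scale shift,
#    `scaleShiftRate_sinLast`), node U2's stationary functional is `betaInf β (u,u,…) = sin(1∕u)` (`betaInf_sinLast`), and NO number b⋆ has part 11's defining property on any box, for any constant and any
#    θ < 1 (`no_bstar_sinLast`) — indeed `u ↦ betaInf β (u,u,…)` has no limit at 0⁺ at all (`not_tendsto_sinLast`): without the moduli the β-functions need not settle to one value at zero coupling.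
# §2 THE MODULI WITHOUT NE4 — the history-free scale-alternating family `β_{k+1} = (−1)^k` (the gaps cell's `altBeta` phenomenon in its barest form): `HistLipschitz 0 γ` and `FadingMemory C θ 0` hold for
#    every C ≥ 0, θ ≥ 0 (`histLipschitz_alt`, `fadingMemory_alt`), yet NO number b admits part 11's sandwich shape `|β_{k+1}(u,…,u) − b| ≤ Au + cθ^k∕(1−θ)` (θ < 1) on any box (`no_sandwich_alt`): without NE4
#    there is no eventual value at all.
# (β-flow team, prover 2 = lower ∕ positivity side, unit `b2b-balaban-beta-bflow-p2`, gen 49; witness part of part 11)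

HONEST FRAMING (page 1 of everything the β sub-cell writes): discharging `BetaPertH` makes Bałaban's UV stability UNCONDITIONAL — a
real constructive-QFT result; it is NOT the continuum limit and NOT the Clay problem.  HONEST DEPENDENCY (cell reorg 2026-08-19,
verbatim): «continuum YM on T⁴ ⇐ BetaPertH ∧ nine spine estimates (0/9 proved); BetaPertH ⇐ (D1) ∧ (D4) ∧ CAP+tail; G-an2-4 gates
asym, D1 and NE2/3/4.»  THIS MODULE DISCHARGES NOTHING and asserts nothing about Bałaban's β-functions: the two families are TOYS (elementary real analysis, [folklore]), used only to
show that the hypotheses of part 11's `exists_bstar` ∕ `abs_beta_sub_bstar_le` (node U2's HYPOTHESIS SHAPES `HistLipschitz ∕ FadingMemory ∕ ScaleShiftRate`, NOT printed: [Balaban1987RG1] = T. Bałaban, Commun.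
Math. Phys. **109** (1987) p. 298 ∕ p. 264; GAPS G-t4-U2-1∕2) cannot be weakened to either letter alone.  0 def (the toys are lambdas), 0 sorry.

WHAT THIS FILE PROVES: §1 `scaleShiftRate_sinLast`, `betaInf_sinLast`, **`no_bstar_sinLast`**, `not_tendsto_sinLast`; §2 `histLipschitz_alt`, `fadingMemory_alt`, **`no_sandwich_alt`**.
NOT CLAIMED: anything about Bałaban's β; which letter print intends; Theorem 2; `BetaPertH`; continuum; Clay.
-/

namespace Summit.QuantumFields.BalabanUV.Beta.EriceFlowEnclosureB12AsPrintedPointwiseFadingLimitWitness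

open Finset Filter Topology
open Literature.MathematicalPhysics.QuantumFieldTheory.Balaban1983to89
open Literature.MathematicalPhysics.QuantumFieldTheory.Balaban1983to89.FlowStep (HBeta prefixOf Box mem_box)
open Literature.MathematicalPhysics.QuantumFieldTheory.Balaban1983to89.T4CouplingMatching (HistLipschitz FadingMemory ScaleShiftRate)
open Literature.MathematicalPhysics.QuantumFieldTheory.Balaban1983to89.T4BetaStationary (SeqBox revHist betaInf)
open Summit.QuantumFields.BalabanUV.Beta.EriceFlowEnclosureB12AsPrintedPointwiseFadingLimit

noncomputable section

/-! ## §1 NE4 without the moduli: `β_{k+1}(g_0,…,g_k) = sin(1∕g_k)` — scale-shift exact, no value at zero coupling -/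

/-- The last-coupling family `β_{k+1}(g_{≤k}) = sin(1∕g_k)` is its own scale shift: `ScaleShiftRate 0 θ γ` for every θ, γ (`Fin.tail` keeps the last entry). [folklore] -/
theorem scaleShiftRate_sinLast (θ γ : ℝ) :
    ScaleShiftRate 0 θ γ (fun k (v : Fin (k + 1) → ℝ) => Real.sin (1 / v (Fin.last k))) := by
  intro k w _
  have htail : Fin.tail w (Fin.last k) = w (Fin.last (k + 1)) := by
    rw [Fin.tail, Fin.succ_last]
  simp only [htail, sub_self, abs_zero, zero_mul, le_refl]

/-- node U2's stationary functional of this family on the constant history is `sin(1∕u)` (the defining sequence is constant). [folklore] -/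
theorem betaInf_sinLast (u : ℝ) :
    betaInf (fun k (v : Fin (k + 1) → ℝ) => Real.sin (1 / v (Fin.last k))) (fun _ : ℕ => u) = Real.sin (1 / u) := by
  unfold betaInf
  have h : (fun k : ℕ => (fun k (v : Fin (k + 1) → ℝ) => Real.sin (1 / v (Fin.last k))) k (revHist (fun _ : ℕ => u) k)) =
      fun _ : ℕ => Real.sin (1 / u) := by
    funext k
    simp [revHist]
  rw [h]
  exact tendsto_const_nhds.limUnder_eq

/-- **NO ASYMPTOTIC CONSTANT WITHOUT THE MODULI.**  For the family `sin(1∕g_k)` (which has `ScaleShiftRate 0 θ γ` for every θ, γ) there is NO number `b⋆`, on ANY box ]0, γ] (γ > 0), with ANY constant A ≥ 0,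
satisfying part 11's defining property `|betaInf β (u,u,…) − b⋆| ≤ A·u` for all `u ∈ ]0, γ]`: at `u = 1∕(π∕2 + 2πn)` the functional is `1`, at `u = 1∕(3π∕2 + 2πn)` it is `−1`, both points as small as we
please. [folklore] -/
theorem no_bstar_sinLast {γ A : ℝ} (hγ : 0 < γ) (hA : 0 ≤ A) :
    ¬ ∃ bstar : ℝ, ∀ u : ℝ, 0 < u → u ≤ γ →
      |betaInf (fun k (v : Fin (k + 1) → ℝ) => Real.sin (1 / v (Fin.last k))) (fun _ : ℕ => u) - bstar| ≤ A * u := by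
  rintro ⟨b, hb⟩
  -- choose n with 1/(π/2 + 2πn) ≤ γ and A/(π/2 + 2πn) < 1 (then also at 3π/2 + 2πn)
  obtain ⟨n, hn⟩ := exists_nat_gt ((1 / γ + A) / (2 * Real.pi))
  have hπ : 0 < Real.pi := Real.pi_pos
  have hX : 1 / γ + A < Real.pi / 2 + 2 * Real.pi * n := by
    have := (div_lt_iff₀ (by positivity : (0 : ℝ) < 2 * Real.pi)).mp hn
    nlinarith
  set x₁ : ℝ := Real.pi / 2 + n * (2 * Real.pi) with hx₁
  set x₂ : ℝ := Real.pi / 2 + Real.pi + n * (2 * Real.pi) with hx₂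
  have hx₁pos : 0 < x₁ := by rw [hx₁]; positivity
  have hx₂pos : 0 < x₂ := by rw [hx₂]; positivity
  have hx₁big : 1 / γ + A < x₁ := by rw [hx₁]; linarith
  have hx₂big : 1 / γ + A < x₂ := by rw [hx₂]; linarith
  have hsin₁ : Real.sin x₁ = 1 := by rw [hx₁, Real.sin_add_nat_mul_two_pi, Real.sin_pi_div_two]
  have hsin₂ : Real.sin x₂ = -1 := by rw [hx₂, Real.sin_add_nat_mul_two_pi, Real.sin_add_pi, Real.sin_pi_div_two]
  -- the two small couplings
  have key : ∀ x : ℝ, 0 < x → 1 / γ + A < x → (0 < 1 / x ∧ 1 / x ≤ γ ∧ A * (1 / x) < 1) := by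
    intro x hx hbig
    have hγinv : 0 < 1 / γ := by positivity
    have hγx : 1 / γ < x := by linarith
    refine ⟨by positivity, ?_, ?_⟩
    · rw [div_le_iff₀ hx]
      have := (div_lt_iff₀ hγ).mp hγx
      linarith
    · rw [← mul_div_assoc, mul_one, div_lt_one hx]; linarith
  obtain ⟨hu₁, hu₁γ, hAu₁⟩ := key x₁ hx₁pos hx₁big
  obtain ⟨hu₂, hu₂γ, hAu₂⟩ := key x₂ hx₂pos hx₂big
  have h₁ := hb (1 / x₁) hu₁ hu₁γ
  have h₂ := hb (1 / x₂) hu₂ hu₂γ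
  rw [betaInf_sinLast, one_div_one_div, hsin₁] at h₁
  rw [betaInf_sinLast, one_div_one_div, hsin₂] at h₂
  have h₁' := (abs_le.mp h₁)
  have h₂' := (abs_le.mp h₂)
  linarith [h₁'.1, h₁'.2, h₂'.1, h₂'.2]

/-- In particular part 11's property with the constant `C∕(1−θ)` (any `C ≥ 0`, any `θ < 1`) fails for this family, and `u ↦ betaInf β (u,u,…)` has NO limit at 0⁺ whatsoever. [folklore] -/
theorem not_tendsto_sinLast (b : ℝ) :
    ¬ Tendsto (fun u : ℝ => betaInf (fun k (v : Fin (k + 1) → ℝ) => Real.sin (1 / v (Fin.last k))) (fun _ : ℕ => u)) (𝓝[>] 0) (𝓝 b) := by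
  intro h
  simp_rw [betaInf_sinLast] at h
  rw [Metric.tendsto_nhdsWithin_nhds] at h
  obtain ⟨δ, hδ, hclose⟩ := h (1 / 2) (by norm_num)
  obtain ⟨n, hn⟩ := exists_nat_gt ((1 / δ) / (2 * Real.pi))
  have hπ : 0 < Real.pi := Real.pi_pos
  have hX : 1 / δ < Real.pi / 2 + 2 * Real.pi * n := by
    have := (div_lt_iff₀ (by positivity : (0 : ℝ) < 2 * Real.pi)).mp hn
    nlinarith
  set x₁ : ℝ := Real.pi / 2 + n * (2 * Real.pi) with hx₁
  set x₂ : ℝ := Real.pi / 2 + Real.pi + n * (2 * Real.pi) with hx₂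
  have hx₁pos : 0 < x₁ := by rw [hx₁]; positivity
  have hx₂pos : 0 < x₂ := by rw [hx₂]; positivity
  have hsin₁ : Real.sin x₁ = 1 := by rw [hx₁, Real.sin_add_nat_mul_two_pi, Real.sin_pi_div_two]
  have hsin₂ : Real.sin x₂ = -1 := by rw [hx₂, Real.sin_add_nat_mul_two_pi, Real.sin_add_pi, Real.sin_pi_div_two]
  have key : ∀ x : ℝ, 0 < x → 1 / δ < x → (1 / x ∈ Set.Ioi (0 : ℝ) ∧ dist (1 / x) 0 < δ) := by
    intro x hx hbig
    refine ⟨Set.mem_Ioi.mpr (by positivity), ?_⟩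
    rw [Real.dist_eq, sub_zero, abs_of_pos (by positivity), div_lt_iff₀ hx]
    have := (div_lt_iff₀ hδ).mp hbig
    linarith
  have h₁ := hclose (key x₁ hx₁pos (by rw [hx₁]; linarith)).1 (key x₁ hx₁pos (by rw [hx₁]; linarith)).2
  have h₂ := hclose (key x₂ hx₂pos (by rw [hx₂]; linarith)).1 (key x₂ hx₂pos (by rw [hx₂]; linarith)).2
  rw [one_div_one_div, hsin₁, Real.dist_eq] at h₁
  rw [one_div_one_div, hsin₂, Real.dist_eq] at h₂
  have h₁' := abs_lt.mp h₁
  have h₂' := abs_lt.mp h₂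
  linarith [h₁'.1, h₁'.2, h₂'.1, h₂'.2]

/-! ## §2 The moduli without NE4: `β_{k+1} = (−1)^k` — Lipschitz with zero moduli, no eventual value -/

/-- The history-free scale-alternating family has the moduli `Λ = 0`. [folklore] -/
theorem histLipschitz_alt (γ : ℝ) : HistLipschitz (fun _ _ => 0) γ (fun k (_ : Fin (k + 1) → ℝ) => (-1 : ℝ) ^ k) := by
  intro k p q _ _
  simp

/-- … which fade (trivially) at any rate: `FadingMemory C θ 0` for `C ≥ 0`, `θ ≥ 0`. [folklore] -/
theorem fadingMemory_alt {C θ : ℝ} (hC : 0 ≤ C) (hθ : 0 ≤ θ) : FadingMemory C θ (fun _ _ => (0 : ℝ)) :=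
  fun k i _ => ⟨le_rfl, by positivity⟩

/-- **NO SANDWICH WITHOUT NE4.**  For the family `(−1)^k` (moduli 0, fading at any rate) there are NO numbers b, A and c with `0 ≤ θ < 1` such that `|β_{k+1}(u,…,u) − b| ≤ A·u + cθ^k∕(1−θ)` for all k and all
`u ∈ ]0, γ]` (γ > 0): at even and odd deep scales and small u the values `±1` would both be within any ε of b. [folklore] -/
theorem no_sandwich_alt {γ θ : ℝ} (hγ : 0 < γ) (hθ0 : 0 ≤ θ) (hθ1 : θ < 1) :
    ¬ ∃ b A c : ℝ, ∀ (k : ℕ) (u : ℝ), 0 < u → u ≤ γ →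
      |(fun k (_ : Fin (k + 1) → ℝ) => (-1 : ℝ) ^ k) k (fun _ : Fin (k + 1) => u) - b| ≤ A * u + c * θ ^ k / (1 - θ) := by
  rintro ⟨b, A, c, h⟩
  have h1θ : 0 < 1 - θ := by linarith
  -- the bound tends to 0 along u → 0⁺ (take u_k := γ θ'^k with θ' = max θ 1/2? simpler: fix ε-argument)
  -- geometric term small at large k, linear term small at small u
  have hgeom : Tendsto (fun k : ℕ => c * θ ^ k / (1 - θ)) atTop (𝓝 (c * 0 / (1 - θ))) :=
    ((tendsto_pow_atTop_nhds_zero_of_lt_one hθ0 hθ1).const_mul c).div_const _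
  rw [mul_zero, zero_div] at hgeom
  obtain ⟨k₀, hk₀⟩ := (Metric.tendsto_atTop.mp hgeom) (1 / 2) (by norm_num)
  -- a small u with |A| u ≤ 1/4
  set u : ℝ := min γ (1 / (4 * (|A| + 1))) with hudef
  have hu : 0 < u := lt_min hγ (by positivity)
  have huγ : u ≤ γ := min_le_left _ _
  have hAu : A * u ≤ 1 / 4 := by
    have h1 : u ≤ 1 / (4 * (|A| + 1)) := min_le_right _ _
    have h2 : (|A| + 1) * u ≤ 1 / 4 := by
      rw [le_div_iff₀ (by positivity)] at h1; nlinarith [hu.le]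
    have h3 : A * u ≤ |A| * u := mul_le_mul_of_nonneg_right (le_abs_self A) hu.le
    nlinarith [abs_nonneg A, hu.le]
  -- even and odd scales beyond k₀
  have e1 : ((-1 : ℝ)) ^ (2 * k₀) = 1 := by rw [pow_mul]; simp
  have e2 : ((-1 : ℝ)) ^ (2 * k₀ + 1) = -1 := by rw [pow_succ, e1]; simp
  have hev : |((-1 : ℝ)) ^ (2 * k₀) - b| ≤ A * u + c * θ ^ (2 * k₀) / (1 - θ) := h (2 * k₀) u hu huγ
  have hod : |((-1 : ℝ)) ^ (2 * k₀ + 1) - b| ≤ A * u + c * θ ^ (2 * k₀ + 1) / (1 - θ) := h (2 * k₀ + 1) u hu huγ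
  rw [e1] at hev
  rw [e2] at hod
  have hg1 := hk₀ (2 * k₀) (by omega)
  have hg2 := hk₀ (2 * k₀ + 1) (by omega)
  rw [Real.dist_eq, sub_zero] at hg1 hg2
  have hev' := abs_le.mp hev
  have hod' := abs_le.mp hod
  have hg1' := (abs_lt.mp hg1).2
  have hg2' := (abs_lt.mp hg2).2
  linarith [hev'.1, hev'.2, hod'.1, hod'.2]

end

end Summit.QuantumFields.BalabanUV.Beta.EriceFlowEnclosureB12AsPrintedPointwiseFadingLimitWitness
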